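import Summits.BirchSwinnertonDyer.Rank1Residual.X12.O11.RouteUEvenTraceForm
import Summits.BirchSwinnertonDyer.Rank1Residual.X12.O11.RouteUKroneckerPsi
import Summits.BirchSwinnertonDyer.Rank1Residual.X12.O11.RouteUKroneckerEven
import Summits.BirchSwinnertonDyer.Rank1Residual.X12.O11.RouteUKroneckerReciprocity
import Summits.BirchSwinnertonDyer.Rank1Residual.X12.O11.RouteUJacobiTwin
import HarnessLib

/-!
# ROUTE U, EVEN members `49a1^{(−4n)}` — the DESCENT side (`7 ∤ #Ш(W)`, Buhler–Gross 1985 Ch. II BY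
# NAME over `ℚ(√−n)`, `d = −4n`) and the TWIN side (`7 ∤ #Ш(W^{(−r)})`, Rubin 1983 Thm C BY NAME over
# `ℚ(√(nr))`, `d = 4nr`; value binder from Burungale–Flach 2024 BY NAME)

bsd-cm cell (run/shared/lean/pub/bsd-cm/), ROUTE U (Theorem U: BSD(49a1^{(D)}, 7)), seat `bsd-cm-ram`
(g6). `RouteUJacobiTwin` did this for the odd members `D = −m`; here `D = −4n` with
`n ≡ 1, 2 (mod 4)` squarefree, `7 ∤ n`, and `χ` is a `ℚ₇`-valued character mod `4n` with the
Kronecker values `χ(a) = [a odd]·(−n/a)` (primitive by `isPrimitive_kroneckerFour`; it IS the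
Kronecker character of `M = ℚ(√−n)`, `isKroneckerCharacterOf_kroneckerFour`). Parameters:
`r ≡ 3 (mod 4)` a prime `≠ 7` not dividing `n` (Heegner field `ℚ(√−r)`, twin `49a1^{(4nr)}`).
Inputs: the two Bernoulli-unit certificate hypotheses (`hcert₁`: `‖B_{1,ω⁴χ_D}‖₇ = 1` at level
`7·4n`; `hcert₂`: `‖B_{1,ωχ_Dχ_{−r}}‖₇ = 1` at level `7·4n·r`). Both named facts are stated for ANY
quadratic field `M` with `7 ∤ d_M`, so the even discriminants need no new fact.

* §0 `4nr` is a fundamental discriminant;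
* §1 `norm_bernoulliOnePrim_mulTeichmuller_pow_four_even` + **`not_seven_dvd_shaOrder_of_buhlerGross_even`**
  — `7 ∤ #Ш(W)` for `W` any model of `49a1^{(−4n)}` of rank `≥ 1`
  (`BuhlerGross1985.firstDescent_seven_oddTwist_of_bernoulli` (iii) with `M = ℚ(√−n)`);
* §2 the character `χ↑·κ_r↑` mod `4n·r` (values `[a odd]·(nr/a)` by
  `jacobiSym_neg_mul_jacobiSym_eq`, primitive, even by `kroneckerFour_even`) and
  **`not_seven_dvd_shaOrder_twin_even`** — `7 ∤ #Ш(Wd)` for every model `Wd` of `W^{(−r)} ≅ 49a1^{(4nr)}`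
  (`Rubin1983.thmC_seven_quadraticField` over `M = ℚ(√(nr))`); `hasCM_twin_even`; `twin_value_even` —
  the twin's VALUE binder from Burungale–Flach 2024 BY NAME.

THEOREMS ONLY; no definitions, no new named facts; nothing booked.
References: [BuhlerGross1985] Ch. II §§7–9; [Rubin1983] Thm C; [KrizLi2019] §1.5, Thm 1.20;
[Cox2013] Lemma 1.14; [Washington1997] §5.1; [BurungaleFlach2024] Thm 1.1.
-/

noncomputable section

open scoped Classical NumberTheorySymbols
open NumberField WeierstrassCurve DirichletCharacter
open Literature.NumberTheory.EllipticCurves Literature.NumberTheory.EllipticCurves.Rank1Residual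
open Literature.NumberTheory.EllipticCurves.KrizLi2019 Literature.NumberTheory.LFunctions
open Literature.NumberTheory.EllipticCurves.Rubin1983 (mulTeichmuller thmC_seven_quadraticField)
open Literature.NumberTheory.QuadraticFields
open Literature.NumberTheory.EllipticCurves.BuhlerGross1985 (firstDescent_seven_oddTwist_of_bernoulli)

namespace Summit.BirchSwinnertonDyer.Rank1Residual.X12.O11.RouteU

/-! ## §0 `4nr` is a fundamental discriminant -/

/-- For `n ≡ 1, 2 (mod 4)` squarefree and a prime `r ≡ 3 (mod 4)` not dividing `n`: `4nr` is a
fundamental discriminant (`nr ≡ 3, 2 (mod 4)` squarefree). [cite: Cox2013, §1.C Lemma 1.14] -/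
theorem isFundamental_four_mul_mul {n r : ℕ} [hr : Fact r.Prime] (hn4 : n % 4 = 1 ∨ n % 4 = 2)
    (hr4 : r % 4 = 3) (hsq : Squarefree n) (hrn : r.Coprime n) :
    ((4 * ((n : ℤ) * r)) % 4 = 1 ∧ Squarefree (4 * ((n : ℤ) * r)) ∧ (4 * ((n : ℤ) * r)) ≠ 1) ∨
      (4 ∣ (4 * ((n : ℤ) * r)) ∧ ((4 * ((n : ℤ) * r)) / 4 % 4 = 2 ∨ (4 * ((n : ℤ) * r)) / 4 % 4 = 3) ∧
        Squarefree ((4 * ((n : ℤ) * r)) / 4)) := by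
  have hdiv : (4 * ((n : ℤ) * r)) / 4 = (n : ℤ) * r := Int.mul_ediv_cancel_left _ (by norm_num)
  refine Or.inr ⟨⟨(n : ℤ) * r, rfl⟩, ?_, ?_⟩
  · rw [hdiv]
    have h : ((n * r : ℕ) : ℤ) % 4 = 3 ∨ ((n * r : ℕ) : ℤ) % 4 = 2 := by
      rcases hn4 with h | h
      · left; exact_mod_cast (show (n * r) % 4 = 3 by rw [Nat.mul_mod, h, hr4])
      · right; exact_mod_cast (show (n * r) % 4 = 2 by rw [Nat.mul_mod, h, hr4])
    push_cast at h
    omega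
  · rw [hdiv, show (n : ℤ) * r = ((n * r : ℕ) : ℤ) by push_cast; rfl, Int.squarefree_natCast,
      Nat.squarefree_mul hrn.symm]
    exact ⟨hsq, hr.out.squarefree⟩

/-! ## §1 `7 ∤ #Ш(W)` from Buhler–Gross 1985 Ch. II BY NAME (`M = ℚ(√−n)`, `d_M = −4n`) -/

section ThetaOne

variable {n : ℕ} [hn : NeZero n] (ω : DirichletCharacter ℚ_[7] 7) (χ : DirichletCharacter ℚ_[7] (4 * n))

/-- `4n ≠ 0`. [folklore] -/
@[instance] theorem neZero_four_mul_level : NeZero (4 * n) := ⟨Nat.mul_ne_zero (by norm_num) hn.out⟩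

omit hn in
/-- The even Kronecker values lie in `{0, 1, −1}`. [folklore] -/
theorem kroneckerVal_trichotomy (a : ℕ) :
    (if Even a then (0 : ℤ) else J(-(n : ℤ) | a)) = 0 ∨ (if Even a then (0 : ℤ) else J(-(n : ℤ) | a)) = 1
      ∨ (if Even a then (0 : ℤ) else J(-(n : ℤ) | a)) = -1 := by
  split_ifs
  · exact Or.inl rfl
  · exact jacobiSym.trichotomy _ _

/-- **`‖B_{1,χ_Mω⁴}‖₇ = 1` in Buhler–Gross's shape from the `θ₁`-certificate**, even member:
`mulTeichmuller (χ↑) (ω⁴)` lifts `θ₁ = χ↑·(ω⁴)↑ = ψ⁻¹` (primitive, `psiJ_inv_isPrimitive`), for a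
primitive `χ` mod `4n` (`n` coprime to `7`) with the Kronecker values `[a odd]·(−n/a)`.
[cite: BuhlerGross1985, Ch. II Prop. (8.3)(1) (p. 17)] [cite: KrizLi2019, §1.5 display (1) (p. 7)] -/
theorem norm_bernoulliOnePrim_mulTeichmuller_pow_four_even (hω : IsTeichmullerCharacter ω)
    (hn7 : (4 * n).Coprime 7)
    (hχ : ∀ a : ℕ, χ (a : ZMod (4 * n)) = ((if Even a then (0 : ℤ) else J(-(n : ℤ) | a) : ℤ) : ℚ_[7]))
    (hχp : χ.IsPrimitive)
    (hcert₁ : ∀ θ : DirichletCharacter ℚ_[7] (7 * (4 * n)),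
        (∀ j : ZMod (7 * (4 * n)), θ j =
          ((if Even j.val then (0 : ℤ) else J(-(n : ℤ) | j.val) : ℤ) : ℚ_[7]) * ω (j.val : ZMod 7) ^ 4) →
        ‖generalizedBernoulli 1 θ‖ = 1)
    {k : ℕ} [NeZero k] (h : 4 * n ∣ k) :
    ‖bernoulliOnePrim (mulTeichmuller (changeLevel h χ) (ω ^ 4))‖ = 1 := by
  have hqq : 7 * (4 * n) ∣ k * 7 := by rw [mul_comm 7 (4 * n)]; exact mul_dvd_mul_right h 7
  have e : mulTeichmuller (changeLevel h χ) (ω ^ 4) =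
      changeLevel hqq (changeLevel (dvd_mul_left (4 * n) 7) χ * changeLevel (dvd_mul_right 7 (4 * n)) (ω ^ 4)) := by
    rw [mulTeichmuller]
    simp only [map_mul, ← changeLevel_trans]
  rw [e, bernoulliOnePrim_changeLevel_eq _
    (by rw [thetaOneK_eq_psiK_inv ω χ _ hχ kroneckerVal_trichotomy]
        exact psiJ_inv_isPrimitive ω χ hn7 hω hχp) hqq]
  exact hcert₁ _ (thetaOneK_apply ω χ _ hχ)

/-- **`7 ∤ #Ш(W)` from Buhler–Gross 1985 Ch. II BY NAME, even member** (named fact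
`BuhlerGross1985.firstDescent_seven_oddTwist_of_bernoulli`, clause (iii), over `M = ℚ(√−n)`,
`d_M = −4n` — the fact is stated for every imaginary quadratic `M` with `7 ∤ d_M`): for `W` any
model of `49a1^{(−4n)}` (`n ≡ 1, 2 (mod 4)` squarefree, `7 ∤ n`) of Mordell–Weil rank `≥ 1` with
`Ш(W)` finite, given a `ℚ₇`-valued character `χ` mod `4n` with the Kronecker values and the
`θ₁`-certificate. `χ` is primitive (`isPrimitive_kroneckerFour`) and is the Kronecker character of `M`
(`isKroneckerCharacterOf_kroneckerFour`).
[cite: BuhlerGross1985, Ch. II Prop. (7.2)(2), (8.3)(1) and Cor. (9.1) proof (pp. 16–18)] -/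
theorem not_seven_dvd_shaOrder_of_buhlerGross_even
    (hBG : BuhlerGross1985.firstDescent_seven_oddTwist_of_bernoulli)
    (hn4 : n % 4 = 1 ∨ n % 4 = 2) (hsq : Squarefree n) (h7n : ¬ 7 ∣ n)
    (hχ : ∀ a : ℕ, χ (a : ZMod (4 * n)) = ((if Even a then (0 : ℤ) else J(-(n : ℤ) | a) : ℤ) : ℚ_[7]))
    (hcert₁ : ∀ (ω : DirichletCharacter ℚ_[7] 7), IsTeichmullerCharacter ω →
      ∀ θ : DirichletCharacter ℚ_[7] (7 * (4 * n)),
        (∀ j : ZMod (7 * (4 * n)), θ j =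
          ((if Even j.val then (0 : ℤ) else J(-(n : ℤ) | j.val) : ℤ) : ℚ_[7]) * ω (j.val : ZMod 7) ^ 4) →
        ‖generalizedBernoulli 1 θ‖ = 1)
    (W : WeierstrassCurve ℚ) [W.IsElliptic]
    (hW : ∃ C : VariableChange ℚ, C • W = cm7.quadraticTwist ((-(4 * (n : ℤ)) : ℤ) : ℚ))
    (hrk : 1 ≤ W.mordellWeilRank) [Finite W.sha] : ¬ 7 ∣ W.shaOrder := by
  haveI : Fact (Nat.Prime 7) := ⟨by norm_num⟩
  have hn0 : 0 < n := Nat.pos_of_ne_zero hn.out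
  have hn7 : (4 * n).Coprime 7 := by
    rw [Nat.coprime_comm, Nat.Prime.coprime_iff_not_dvd (by norm_num)]
    intro h
    exact h7n ((Nat.Prime.dvd_mul (by norm_num)).mp h |>.resolve_left (by norm_num))
  have hχodd : ∀ a : ℕ, Odd a → χ (a : ZMod (4 * n)) = (J(-(n : ℤ) | a) : ℚ_[7]) := fun a ha => by
    rw [hχ a, if_neg (Nat.not_even_iff_odd.mpr ha)]
  have hk : 4 * n = 4 * (-(n : ℤ)).natAbs := by simp
  have hm4 : (-(n : ℤ)) % 4 = 2 ∨ (-(n : ℤ)) % 4 = 3 := by omega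
  have hsq' : Squarefree (-(n : ℤ)) := by rw [← Int.squarefree_natAbs]; simpa using hsq
  have hχp : χ.IsPrimitive := isPrimitive_kroneckerFour hk hm4 hsq' hχodd
  obtain ⟨ω, hω⟩ := exists_isTeichmullerCharacter (p := 7)
  obtain ⟨M, _, _, hM2, hdM⟩ := Quadratic.exists_numberField_discr_eq (isFundamental_neg_four_mul hn4 hsq)
  have hnat : (NumberField.discr M).natAbs = 4 * n := by
    rw [hdM, Int.natAbs_neg, show (4 * (n : ℤ)) = ((4 * n : ℕ) : ℤ) by push_cast; ring, Int.natAbs_natCast]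
  haveI : NeZero (NumberField.discr M).natAbs := ⟨by rw [hnat]; exact NeZero.ne _⟩
  have hMim : IsImaginaryQuadratic M :=
    ⟨hM2, Quadratic.isTotallyComplex_of_discr_neg hM2 (by rw [hdM]; omega)⟩
  have h7M : ¬ ((7 : ℤ) ∣ NumberField.discr M) := by
    rw [hdM, dvd_neg]
    intro h
    have h' : ((7 : ℕ) : ℤ) ∣ (n : ℤ) := (Int.Prime.dvd_mul' (by norm_num) h).resolve_left (by norm_num)
    exact h7n (by exact_mod_cast h')
  have hdiv : 4 * n ∣ (NumberField.discr M).natAbs := by rw [hnat]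
  have hεM : IsKroneckerCharacterOf M (changeLevel hdiv χ) :=
    isKroneckerCharacterOf_kroneckerFour hM2 (m := -(n : ℤ)) (by rw [hdM]; ring) χ hχp hχodd hk hdiv
  have hB : ¬ (‖bernoulliOnePrim (mulTeichmuller (changeLevel hdiv χ) (ω ^ 4))‖ ≤ (7 : ℝ)⁻¹) := by
    rw [norm_bernoulliOnePrim_mulTeichmuller_pow_four_even ω χ hω hn7 hχ hχp (hcert₁ ω hω) hdiv]
    norm_num
  have hW' : ∃ C : VariableChange ℚ, C • W = cm7.quadraticTwist (NumberField.discr M : ℚ) := by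
    rw [hdM]; exact hW
  obtain ⟨-, -, hsha⟩ := hBG ω hω M hMim h7M (changeLevel hdiv χ) hεM hB W hW'
  intro h7
  obtain ⟨x, hx⟩ := exists_prime_addOrderOf_dvd_card' (G := W.sha) 7 h7
  have hx0 : x ≠ 0 := by
    intro h0; rw [h0, addOrderOf_zero] at hx; norm_num at hx
  have h7x' : (7 : ℕ) • x = 0 := by rw [← hx]; exact addOrderOf_nsmul_eq_zero x
  have h7x : (7 : ℕ) • (x : W.galH1) = 0 := by exact_mod_cast congrArg Subtype.val h7x'
  exact hx0 (Subtype.ext (hsha hrk x x.2 h7x))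

end ThetaOne

/-! ## §2 The twin `Wd ≅ 49a1^{(4nr)}`: CM, `7 ∤ #Ш(Wd)` (Rubin Thm C BY NAME), the value binder -/

section Twin

variable {n r : ℕ} [hn : NeZero n] [hr : Fact r.Prime]
  (χ : DirichletCharacter ℚ_[7] (4 * n)) (κ : DirichletCharacter ℚ_[7] r)

/-- `4n·r ≠ 0`. [folklore] -/
@[instance] theorem neZero_four_mul_level_mul_prime : NeZero (4 * n * r) :=
  ⟨Nat.mul_ne_zero (NeZero.ne _) hr.out.ne_zero⟩

omit hn in
/-- **Values of `χ↑·κ↑` mod `4n·r`: `[a odd]·(nr / a)`** for `χ` with the Kronecker values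
`[a odd]·(−n/a)` mod `4n` and `κ` Legendre mod `r ≡ 3 (mod 4)` (`(−n/a)(a/r) = (nr/a)` for odd `a`,
`RouteUKroneckerReciprocity.jacobiSym_neg_mul_jacobiSym_eq`). [cite: Cox2013, §1.C Lemma 1.14] -/
theorem kroneckerTwin_apply (hr4 : r % 4 = 3)
    (hχ : ∀ a : ℕ, χ (a : ZMod (4 * n)) = ((if Even a then (0 : ℤ) else J(-(n : ℤ) | a) : ℤ) : ℚ_[7]))
    (hκ : ∀ a : ℕ, κ (a : ZMod r) = (legendreSym r (a : ℤ) : ℚ_[7])) (a : ℕ) (ha : Odd a) :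
    (changeLevel (dvd_mul_right (4 * n) r) χ * changeLevel (dvd_mul_left r (4 * n)) κ)
        (a : ZMod (4 * n * r)) = (J((n : ℤ) * r | a) : ℚ_[7]) := by
  have hJ : J((n : ℤ) * r | a) = J(-(n : ℤ) | a) * legendreSym r a := by
    rw [jacobiSym.legendreSym.to_jacobiSym, jacobiSym_neg_mul_jacobiSym_eq hr4 ha]
  have ha' : ((a : ℤ) : ZMod (4 * n * r)) = (a : ZMod (4 * n * r)) := Int.cast_natCast a
  by_cases hu : IsCoprime (a : ℤ) ((4 * n * r : ℕ) : ℤ)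
  · rw [← ha', MulChar.mul_apply, changeLevel_eq_cast_of_dvd' _ _ hu,
      changeLevel_eq_cast_of_dvd' _ _ hu, Int.cast_natCast, Int.cast_natCast, hχ, hκ, hJ,
      if_neg (Nat.not_even_iff_odd.mpr ha), Int.cast_mul]
  · have hnu : ¬ IsUnit (a : ZMod (4 * n * r)) := by
      rw [← ha', ZMod.coe_int_isUnit_iff_isCoprime]; exact fun h => hu (isCoprime_comm.mp h)
    rw [MulChar.map_nonunit _ hnu]
    -- `a` odd and not coprime to `4nr`: `gcd(nr, a) ≠ 1`
    have hna : ¬ a.Coprime (4 * n * r) := fun h => hu (Nat.isCoprime_iff_coprime.mpr h)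
    have hg : ((n : ℤ) * r).gcd a ≠ 1 := by
      intro h1
      apply hna
      have h4 : a.Coprime 4 := by simpa using Nat.Coprime.pow_right 2 (Nat.coprime_two_right.mpr ha)
      have hnr : a.Coprime (n * r) := by
        rw [show (n : ℤ) * r = ((n * r : ℕ) : ℤ) by push_cast; rfl, Int.gcd_natCast_natCast] at h1
        exact Nat.coprime_comm.mp h1
      rw [mul_assoc]
      exact Nat.Coprime.mul_right h4 hnr
    haveI : NeZero a := ⟨ha.pos.ne'⟩
    rw [jacobiSym.eq_zero_iff_not_coprime.mpr hg, Int.cast_zero]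

/-- `χ↑·κ↑` mod `4n·r` is **primitive** (`χ` primitive mod `4n`, `κ` Legendre mod the odd prime `r`
not dividing `4n`). [folklore] -/
theorem kroneckerTwin_isPrimitive (hrn : r.Coprime (4 * n)) (hr2 : r ≠ 2) (hχp : χ.IsPrimitive)
    (hκ : ∀ a : ℕ, κ (a : ZMod r) = (legendreSym r (a : ℤ) : ℚ_[7])) :
    (changeLevel (dvd_mul_right (4 * n) r) χ * changeLevel (dvd_mul_left r (4 * n)) κ).IsPrimitive := by
  have hcq : χ.conductor = 4 * n := hχp
  have hcr := conductor_eq_of_prime_of_ne_one κ (legendreChar_ne_one hr2 κ hκ)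
  change DirichletCharacter.conductor _ = 4 * n * r
  rw [conductor_changeLevel_mul_changeLevel _ _ χ κ (by rw [hcq, hcr]; exact hrn.symm), hcq, hcr]

omit hn hr in
/-- **The twin `Wd` (a model of `(49a1^{(−4n)})^{(−r)} ≅ 49a1^{(4nr)}`) is a CM curve.**
[cite: SilvermanATAEC1994, App. A §3 (table of CM j-invariants)] -/
theorem hasCM_twin_even (hn0 : 0 < n) (hr0 : 0 < r) (W : WeierstrassCurve ℚ)
    (hW : ∃ C : VariableChange ℚ, C • W = cm7.quadraticTwist ((-(4 * (n : ℤ)) : ℤ) : ℚ))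
    (Wd : WeierstrassCurve ℚ) [Wd.IsElliptic] (Cd : VariableChange ℚ)
    (hWd : Cd • W.quadraticTwist ((-(r : ℤ) : ℤ) : ℚ) = Wd) : Wd.HasCM := by
  obtain ⟨C', hC'⟩ := exists_variableChange_cm7_twist_twist W hW Wd Cd hWd
  have e : cm7.quadraticTwist (((-(4 * (n : ℤ)) : ℤ) : ℚ) * ((-(r : ℤ) : ℤ) : ℚ)) =
      cm7.quadraticTwist (((4 * n * r : ℕ) : ℤ) : ℚ) := by push_cast; ring_nf
  have hne : ((4 * n * r : ℕ) : ℤ) ≠ 0 := by positivity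
  exact hasCM_of_twist_cm7 Wd hne ⟨C'⁻¹, by rw [← hC', inv_smul_smul, e]⟩

/-- **The twin side BY NAME, even member**: for every model `W` of `49a1^{(−4n)}` (`n ≡ 1, 2 (mod 4)`
squarefree, `7 ∤ n`) and every elliptic model `Wd` of `W^{(−r)}` (`≅ 49a1^{(4nr)}`; `r ≡ 3 (mod 4)`
a prime `≠ 7` not dividing `n`) with `Ш(Wd)` finite: `7 ∤ #Ш(Wd)` — Rubin 1983 Thm C at `p = 7`
over the REAL field `M = ℚ(√(nr))` of discriminant `4nr` (named fact `thmC_seven_quadraticField`),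
its Bernoulli conditions discharged by `‖B_{1,ω}‖₇ = 1` (kernel) and the `θ₂`-certificate; the
Kronecker character of `M` is `χ↑·κ_r↑` (values `(nr/·)`, primitive, even).
[cite: Rubin1983, §0 Thm. C (p. 341)] [cite: BuhlerGross1985, Prop. (8.4)(1) and Cor. (9.1) (p. 18)] -/
theorem not_seven_dvd_shaOrder_twin_even (h : thmC_seven_quadraticField)
    (hn4 : n % 4 = 1 ∨ n % 4 = 2) (hsq : Squarefree n) (h7n : ¬ 7 ∣ n) (hr4 : r % 4 = 3)
    (hr7 : r ≠ 7) (hrn : r.Coprime n)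
    (hχ : ∀ a : ℕ, χ (a : ZMod (4 * n)) = ((if Even a then (0 : ℤ) else J(-(n : ℤ) | a) : ℤ) : ℚ_[7]))
    (hcert₂ : ∀ (ω : DirichletCharacter ℚ_[7] 7), IsTeichmullerCharacter ω →
      ∀ θ : DirichletCharacter ℚ_[7] (7 * (4 * n) * r),
        (∀ j : ZMod (7 * (4 * n) * r), θ j =
          (((if Even j.val then (0 : ℤ) else J(-(n : ℤ) | j.val)) * J((j.val : ℤ) | r) : ℤ) : ℚ_[7]) *
            ω (j.val : ZMod 7) ^ 1) →
        ‖generalizedBernoulli 1 θ‖ = 1)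
    (W : WeierstrassCurve ℚ)
    (hW : ∃ C : VariableChange ℚ, C • W = cm7.quadraticTwist ((-(4 * (n : ℤ)) : ℤ) : ℚ))
    (Wd : WeierstrassCurve ℚ) [Wd.IsElliptic] (Cd : VariableChange ℚ)
    (hWd : Cd • W.quadraticTwist ((-(r : ℤ) : ℤ) : ℚ) = Wd) [Finite Wd.sha] :
    ¬ 7 ∣ Wd.shaOrder := by
  have hn0 : 0 < n := Nat.pos_of_ne_zero hn.out
  have hr2 : r ≠ 2 := by rintro rfl; norm_num at hr4
  have hr7' : r.Coprime 7 := (Nat.coprime_primes hr.out (by norm_num)).mpr hr7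
  have hn7 : (4 * n).Coprime 7 := by
    rw [Nat.coprime_comm, Nat.Prime.coprime_iff_not_dvd (by norm_num)]
    intro hd
    exact h7n ((Nat.Prime.dvd_mul (by norm_num)).mp hd |>.resolve_left (by norm_num))
  have hrn4 : r.Coprime (4 * n) := Nat.Coprime.mul_right
    (by simpa using Nat.Coprime.pow_right 2 ((Nat.coprime_primes hr.out Nat.prime_two).mpr hr2)) hrn
  have hχodd : ∀ a : ℕ, Odd a → χ (a : ZMod (4 * n)) = (J(-(n : ℤ) | a) : ℚ_[7]) := fun a ha => by
    rw [hχ a, if_neg (Nat.not_even_iff_odd.mpr ha)]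
  have hχp : χ.IsPrimitive := isPrimitive_kroneckerFour (m := -(n : ℤ)) (by simp) (by omega)
    (by rw [← Int.squarefree_natAbs]; simpa using hsq) hχodd
  obtain ⟨ω, hω⟩ := exists_isTeichmullerCharacter (p := 7)
  obtain ⟨M, _, _, hM2, hdM⟩ := Quadratic.exists_numberField_discr_eq
    (isFundamental_four_mul_mul hn4 hr4 hsq hrn)
  have hnat : (NumberField.discr M).natAbs = 4 * n * r := by
    rw [hdM, show (4 : ℤ) * ((n : ℤ) * r) = ((4 * n * r : ℕ) : ℤ) by push_cast; ring, Int.natAbs_natCast]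
  haveI : NeZero (NumberField.discr M).natAbs := ⟨by rw [hnat]; exact NeZero.ne _⟩
  obtain ⟨κ', hκ'⟩ := exists_legendreCharacter r
  -- the Kronecker character of `M = ℚ(√(nr))`
  set κM := changeLevel (dvd_mul_right (4 * n) r) χ * changeLevel (dvd_mul_left r (4 * n)) κ' with hκM
  have hdiv : 4 * n * r ∣ (NumberField.discr M).natAbs := by rw [hnat]
  have hkM : 4 * n * r = 4 * ((n : ℤ) * r).natAbs := by
    rw [Int.natAbs_mul, Int.natAbs_natCast, Int.natAbs_natCast]; ring
  have hK : IsKroneckerCharacterOf M (changeLevel hdiv κM) :=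
    isKroneckerCharacterOf_kroneckerFour hM2 hdM κM (kroneckerTwin_isPrimitive χ κ' hrn4 hr2 hχp hκ')
      (kroneckerTwin_apply χ κ' hr4 hχ hκ') hkM hdiv
  have heven : (changeLevel hdiv κM).Even := by
    change changeLevel hdiv κM (-1) = 1
    have hc : IsCoprime (-1 : ℤ) (((NumberField.discr M).natAbs : ℕ) : ℤ) := isCoprime_one_left.neg_left
    have hv := changeLevel_eq_cast_of_dvd' κM hdiv hc
    push_cast at hv
    rw [hv]
    have hmr4 : ((n : ℤ) * r) % 4 = 2 ∨ ((n : ℤ) * r) % 4 = 3 := by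
      rcases hn4 with h4 | h4
      · right; exact_mod_cast (show (n * r) % 4 = 3 by rw [Nat.mul_mod, h4, hr4])
      · left; exact_mod_cast (show (n * r) % 4 = 2 by rw [Nat.mul_mod, h4, hr4])
    exact kroneckerFour_even hkM (mul_pos (by exact_mod_cast hn0) (by exact_mod_cast hr.out.pos)) hmr4
      (kroneckerTwin_apply χ κ' hr4 hχ hκ')
  have h7 : ¬ ((7 : ℤ) ∣ NumberField.discr M) := by
    rw [hdM]
    intro hdvd
    have : (7 : ℕ) ∣ 4 * n * r := by
      rw [show (4 : ℤ) * ((n : ℤ) * r) = ((4 * n * r : ℕ) : ℤ) by push_cast; ring] at hdvd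
      exact_mod_cast hdvd
    rcases (Nat.Prime.dvd_mul (by norm_num)).mp this with h | h
    · exact absurd (Nat.Coprime.eq_one_of_dvd hn7.symm h) (by norm_num)
    · exact hr7 (((Nat.prime_dvd_prime_iff_eq (by norm_num) hr.out).mp h).symm)
  have hB₁ := not_norm_mul_le_inv_of_norm_eq_one (p := 7)
    (norm_bernoulliOnePrim_teichmuller_seven ω hω) (norm_bernoulliOnePrim_teichmuller_seven ω hω)
  have hκ'J : ∀ a : ℕ, κ' (a : ZMod r) = (jacobiSym (a : ℤ) r : ℚ_[7]) := fun a => by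
    rw [hκ', jacobiSym.legendreSym.to_jacobiSym]
  have hκ'p : κ'.IsPrimitive := conductor_eq_of_prime_of_ne_one κ' (legendreChar_ne_one hr2 κ' hκ')
  have hu2 : ‖bernoulliOnePrim (mulTeichmuller (changeLevel hdiv κM) ω)‖ = 1 := by
    have e : mulTeichmuller (changeLevel hdiv κM) ω =
        changeLevel (mul_dvd_mul_right hdiv 7) (mulTeichmuller κM ω) := by
      rw [mulTeichmuller, mulTeichmuller]
      simp only [map_mul, ← changeLevel_trans]
    rw [e, bernoulliOnePrim_changeLevel]
    exact norm_bernoulliOnePrim_mulTeichmuller_J χ ω hω hn7 hr7' hrn4 κ' hκ'p hχp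
      (hcert₂ ω hω _ (thetaTwoK_apply ω χ _ κ' _ hχ hκ'J))
  have hB₂ := not_norm_mul_le_inv_of_norm_eq_one (p := 7) hu2 hu2
  have hWd' : ∃ C' : VariableChange ℚ, C' • cm7.quadraticTwist (NumberField.discr M : ℚ) = Wd := by
    have e : ((NumberField.discr M : ℤ) : ℚ) = ((-(4 * (n : ℤ)) : ℤ) : ℚ) * ((-(r : ℤ) : ℤ) : ℚ) := by
      rw [hdM]; push_cast; ring
    rw [e]
    exact exists_variableChange_cm7_twist_twist W hW Wd Cd hWd
  exact_mod_cast Rubin1983.not_dvd_shaOrder_twist_of_bernoulli h ω hω M hM2 h7 (changeLevel hdiv κM) hK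
    (by exact_mod_cast hB₁) heven (by exact_mod_cast hB₂) Wd hWd'

omit hn in
/-- **The twin's VALUE binder `htw` from Burungale–Flach 2024 (BY NAME), even member** (`n, r > 0`).
[cite: BurungaleFlach2024, Thm 1.1 and Cor. 2] [cite: Miller2011LMS, §1 and Def. 1.1 (arXiv:1010.2431 p. 3)] -/
theorem twin_value_even (hBF : bsdTriple_of_hasCM_of_L_one_ne_zero)
    (hGZK : rank_eq_analyticRank_of_analyticRank_le_one) (hmod : hasEntireLFunction_rat) (hn0 : 0 < n)
    (W : WeierstrassCurve ℚ) [W.IsElliptic]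
    (hW : ∃ C : VariableChange ℚ, C • W = cm7.quadraticTwist ((-(4 * (n : ℤ)) : ℤ) : ℚ))
    (Wd : WeierstrassCurve ℚ) [Wd.IsElliptic] [Wd.IsGloballyMinimal] (Cd : VariableChange ℚ)
    (hWd : Cd • W.quadraticTwist ((-(r : ℤ) : ℤ) : ℚ) = Wd)
    (hLt : (W.quadraticTwist ((-(r : ℤ) : ℤ) : ℚ)).entireLFunction 1 ≠ 0) :
    ∃ x : ℚ, Wd.entireLFunction 1 / (Wd.realPeriodRat : ℂ) = (x : ℂ) ∧
      padicValRat 7 x = (padicValNat 7 Wd.shaOrder : ℤ) + padicValNat 7 Wd.tamagawaProduct -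
        2 * padicValNat 7 Wd.torsionOrder := by
  haveI : Fact (Nat.Prime 7) := ⟨by norm_num⟩
  have hCM : Wd.HasCM := hasCM_twin_even hn0 hr.out.pos W hW Wd Cd hWd
  have hL : Wd.entireLFunction 1 ≠ 0 := by
    have h' : W.quadraticTwist ((-(r : ℤ) : ℤ) : ℚ) = Cd⁻¹ • Wd := by rw [← hWd, inv_smul_smul]
    rw [h', entireLFunction_smul] at hLt
    exact hLt
  have hr0 : Wd.analyticRank = 0 := (analyticRank_eq_zero_iff_holds (W := Wd) (hmod Wd)).mpr hL
  exact X11b.Three.exists_LOne_div_realPeriodRat_of_bsdp_rankZero hGZK hmod Wd 7 hr0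
    (forall_bsdp_of_bsdTriple' Wd (hBF Wd hCM hL) 7 (by norm_num))

end Twin

end Summit.BirchSwinnertonDyer.Rank1Residual.X12.O11.RouteU

end
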